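import Literature.Probability.RandomPlanarGeometry.RestrictionDerivTime
import Literature.Probability.RandomPlanarGeometry.SLEKappaRhoRestriction
import HarnessLib

/-!
# Alive times of a hull under the Loewner flow: persistence under small steps, and degeneracy at `T_A`

Deterministic Loewner calculus for [LSW] §5 (G. F. Lawler, O. Schramm, W. Werner, *Conformal
restriction: the chordal case*, JAMS **16** (2003), arXiv:math/0209343), where for `A ∈ 𝒬*`
the maps `h_t = g_{A_t}`, `A_t = g_t(A)`, are used "for `t < T`",
`T = T_A = inf{t : K_t ∩ A ≠ ∅}`. For a continuous driving function `W` and the hitting time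
`Loewner.hullHitTime W A` (`SLEKappaRhoRestriction`) of the closed hulls we prove:

* `Loewner.coe_add_lt_swallowingTime_of_margin` — **persistence of a single point**: if
  `|g_s(z) − W_s| ≥ m` and the driver oscillates by `≤ Ω` on `[s, s + h]` with
  `4h/m + Ω < m/2`, then `z` is still alive at `s + h` (the forward tube
  `norm_map_sub_ge_of_after` of `LoewnerTube` keeps the flow `m/2`-away from the driver on
  `[s, b)` for every alive `b ≤ s + h`, so by the extension criterion
  `IsSolution.coe_lt_swallowingTime_of_le_norm_sub` the lifetime exceeds `s + h`);
* `Loewner.disjoint_closedHull_add_of_margin` — the same for a set `A ⊆ ℍ̄` at uniform margin;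
* `Loewner.lt_hullHitTime_of_disjoint`, `Loewner.disjoint_closedHull_iff_lt_hullHitTime` — the
  alive times of a nonempty `*`-hull are EXACTLY `[0, T_A)` (an alive time is followed by alive
  times: the margin `dist(0, B_s) > 0` and the continuity of `W` at `s`);
* `Loewner.exists_infDist_slidHull_lt` — **degeneracy at a finite hitting time**: if
  `T_A < ∞` then `dist(W_t, g_t(A)) = dist(0, B_t)` comes below every `μ > 0` at times
  `t ∈ [s, T_A)`, for every `s < T_A` (otherwise the margin `μ` on `[s, T_A)` and a short step
  would carry `A` alive past `T_A`);
* `Loewner.continuousOn_starDeriv_slidHull`, `Loewner.continuousOn_infDist_slidHull` — the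
  continuity of `t ↦ Φ'_{B_t}(0) = h_t'(W_t)` and `t ↦ dist(0, B_t)` on `[0, T_A)`
  (`RestrictionDerivTime`, restated on `{t | t < T_A}`).

These are the pathwise inputs of the localization `τ_k ↑ T_A` of the restriction martingale
`h_t'(W_t)^{5/8}` ([LSW] Prop. 5.3: "`Y_t`, `t < T`, is a bounded martingale").

## References

* [LSW] §5 (T_A, A_t, h_t). [LawlerSchrammWerner2003Restriction]
* G. F. Lawler, *Conformally Invariant Processes in the Plane* (2005), Lemma 4.13, §4.1
  (extension of the flow while away from the driving function). [Lawler2005]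
-/

noncomputable section

open Set Filter Metric Function
open _root_.Complex _root_.Topology
open UpperHalfPlane (upperHalfPlaneSet)
open scoped NNReal

namespace Literature.Probability.RandomPlanarGeometry

namespace Loewner

variable {W : ℝ≥0 → ℝ} {A : Set ℂ}

/-- Aliveness of `A ⊆ ℍ̄` at time `t` is the pointwise condition `t < T_a`, `a ∈ A` (local copy of
`Loewner.disjoint_closedHull_iff` of `SLERestrictionAdapted`, to keep the imports deterministic).
[folklore] -/
private theorem disjoint_closedHull_iff' (hA : A ⊆ closure upperHalfPlaneSet) {t : ℝ≥0} :
    Disjoint (closedHull W t) A ↔ ∀ a ∈ A, (t : WithTop ℝ≥0) < swallowingTime W a := by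
  refine ⟨fun h a ha ↦ lt_swallowingTime_of_disjoint_closedHull hA h ha, fun h ↦ ?_⟩
  exact Set.disjoint_left.2 fun z hz hzA ↦ (h z hzA).not_ge hz.2

/-! ### Persistence of aliveness under a small step -/

/-- **A point at margin `m` from the driver stays alive through a short calm step**: if
`s < T_z`, `|g_s(z) − W_s| ≥ m > 0`, `|W_r − W_s| ≤ Ω` for `r ∈ [s, s + h]` and
`4h/m + Ω < m/2`, then `s + h < T_z`. [cite: Lawler2005, Lemma 4.13] -/
theorem coe_add_lt_swallowingTime_of_margin (hW : Continuous W) {z : ℂ} {s h : ℝ≥0}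
    (hs : (s : WithTop ℝ≥0) < swallowingTime W z) {m Ω : ℝ} (hm : 0 < m)
    (hms : m ≤ ‖map W s z - W s‖) (hΩ : ∀ r : ℝ≥0, s ≤ r → r ≤ s + h → |W r - W s| ≤ Ω)
    (hsmall : 4 * (h : ℝ) / m + Ω < m / 2) :
    ((s + h : ℝ≥0) : WithTop ℝ≥0) < swallowingTime W z := by
  by_contra hle
  rw [not_lt] at hle
  -- `T_z = b` with `s < b ≤ s + h`
  obtain ⟨b, hb⟩ : ∃ b : ℝ≥0, swallowingTime W z = b := by
    induction hT : swallowingTime W z with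
    | top => exact absurd hle (by rw [hT]; exact not_le.2 (WithTop.coe_lt_top _))
    | coe b => exact ⟨b, rfl⟩
  rw [hb] at hle hs
  have hsb : s < b := WithTop.coe_lt_coe.1 hs
  have hbsh : b ≤ s + h := WithTop.coe_le_coe.1 hle
  have hbpos : 0 < b := pos_of_gt hsb
  have hz : z ≠ W 0 := ne_driving_of_lt_swallowingTime (hb ▸ hs : (s : WithTop ℝ≥0) < swallowingTime W z)
  obtain ⟨G, hG⟩ := exists_isSolution_swallowingTime_holds hW hz
  rw [hb] at hG
  -- margin `δ₀` on `[0, s]`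
  obtain ⟨δ₀, hδ₀, hfar₀⟩ := hG.exists_le_norm_sub hW (b := (s : ℝ)) s.coe_nonneg (by simpa using hs)
  -- margin `m / 2` on `[s, b)` by the forward tube
  have hfar₁ : ∀ v : ℝ≥0, s ≤ v → v < b → m / 2 < ‖map W v z - W v‖ := by
    intro v hsv hvb
    have hvT : (v : WithTop ℝ≥0) < swallowingTime W z := by rw [hb]; exact_mod_cast hvb
    have hvh : v ≤ s + h := hvb.le.trans hbsh
    have hsmallv : 4 * ((v : ℝ) - s) / m + Ω < m / 2 := by
      have h1 : (v : ℝ) - s ≤ h := by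
        have : (v : ℝ) ≤ s + h := by exact_mod_cast hvh
        linarith
      have h2 : 4 * ((v : ℝ) - s) / m ≤ 4 * (h : ℝ) / m := by gcongr
      linarith
    exact (norm_map_sub_ge_of_after hW hsv hvT hm hms (fun r hr1 hr2 ↦ hΩ r hr1 (hr2.trans hvh))
      hsmallv hsv le_rfl).1
  -- hence a positive margin on `[0, b)` for the solution `G`
  set δ : ℝ := min (δ₀ : ℝ) (m / 2) with hδ
  have hδpos : 0 < δ := lt_min (NNReal.coe_pos.2 hδ₀) (by linarith)
  have hfar : ∀ t : ℝ, 0 ≤ t → t < b → ((⟨δ, hδpos.le⟩ : ℝ≥0) : ℝ) ≤ ‖G t - W t.toNNReal‖ := by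
    intro t ht0 htb
    change δ ≤ _
    rcases le_or_gt t s with hts | hts
    · exact (min_le_left _ _).trans (hfar₀ t ⟨ht0, hts⟩)
    · have hv : s ≤ t.toNNReal := by
        rw [← NNReal.coe_le_coe, Real.coe_toNNReal t ht0]; exact hts.le
      have hvb : t.toNNReal < b := by
        rw [← NNReal.coe_lt_coe, Real.coe_toNNReal t ht0]; exact htb
      have h1 := hfar₁ t.toNNReal hv hvb
      have hvT : ((t.toNNReal : ℝ≥0) : WithTop ℝ≥0) < (b : WithTop ℝ≥0) := by exact_mod_cast hvb
      rw [map_eq_of_isSolution hW hG hvT, Real.coe_toNNReal t ht0] at h1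
      exact (min_le_right _ _).trans h1.le
  have hlt := hG.coe_lt_swallowingTime_of_le_norm_sub hW hbpos hδpos hfar
  rw [hb] at hlt
  exact lt_irrefl _ hlt

/-- **A set at uniform margin stays alive through a short calm step**: if every `a ∈ A ⊆ ℍ̄`
is alive at `s` with `|g_s(a) − W_s| ≥ m`, `|W_r − W_s| ≤ Ω` on `[s, s + h]` and
`4h/m + Ω < m/2`, then the closed hull at time `s + h` still misses `A`.
[cite: Lawler2005, Lemma 4.13] -/
theorem disjoint_closedHull_add_of_margin (hW : Continuous W) (hAH : A ⊆ closure upperHalfPlaneSet)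
    {s h : ℝ≥0} (hs : Disjoint (closedHull W s) A) {m Ω : ℝ} (hm : 0 < m)
    (hms : ∀ a ∈ A, m ≤ ‖map W s a - W s‖)
    (hΩ : ∀ r : ℝ≥0, s ≤ r → r ≤ s + h → |W r - W s| ≤ Ω) (hsmall : 4 * (h : ℝ) / m + Ω < m / 2) :
    Disjoint (closedHull W (s + h)) A :=
  (disjoint_closedHull_iff' hAH).2 fun a ha ↦ coe_add_lt_swallowingTime_of_margin hW
    ((disjoint_closedHull_iff' hAH).1 hs a ha) hm (hms a ha) hΩ hsmall

/-- At an alive time of a nonempty `*`-hull, the margin `dist(0, B_s)` bounds `|g_s(a) − W_s|`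
from below for every `a ∈ A`. [folklore] -/
theorem infDist_le_norm_map_sub {s : ℝ≥0} {a : ℂ} (ha : a ∈ A) :
    infDist 0 (slidHull W A s) ≤ ‖map W s a - W s‖ := by
  have := infDist_le_dist_of_mem (x := (0 : ℂ)) (mem_slidHull_iff.2 ⟨a, ha, rfl⟩ : map W s a - W s ∈ slidHull W A s)
  rwa [dist_zero_left] at this

/-- **An alive time is followed by alive times** (the set of alive times is open to the right):
if the closed hull at `s` misses the nonempty `*`-hull `A`, then so does the closed hull at
`s + h` for some `h > 0`. [folklore] -/
theorem exists_disjoint_closedHull_add (hW : Continuous W) (hA : IsStarHull A) (hne : A.Nonempty)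
    {s : ℝ≥0} (hs : Disjoint (closedHull W s) A) :
    ∃ h : ℝ≥0, 0 < h ∧ Disjoint (closedHull W (s + h)) A := by
  have hAH := hA.isBoundedHull.subset_closure
  -- margin `m = dist(0, B_s) > 0`
  obtain ⟨hm0, -⟩ := infDist_zero_pos (isStarHull_slidHull_of_disjoint hW hA hs) (hne.image _)
  set m : ℝ := infDist 0 (slidHull W A s) with hm
  -- modulus of continuity of `W` at `s`: `|W r - W s| ≤ m / 8` for `r ∈ [s, s + η]`
  have hWc : ContinuousAt (fun r : ℝ≥0 ↦ W r) s := hW.continuousAt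
  rw [Metric.continuousAt_iff] at hWc
  obtain ⟨η, hη, hmod⟩ := hWc (m / 8) (by positivity)
  -- the step `h = min (η / 2) (m² / 32)`
  set h : ℝ≥0 := ⟨min (η / 2) (m ^ 2 / 32), by positivity⟩ with hh
  have hhpos : (0 : ℝ) < h := by change (0 : ℝ) < min (η / 2) (m ^ 2 / 32); positivity
  have hhη : (h : ℝ) < η := by
    change min (η / 2) (m ^ 2 / 32) < η; exact (min_le_left _ _).trans_lt (by linarith)
  have hhm : (h : ℝ) ≤ m ^ 2 / 32 := min_le_right _ _
  refine ⟨h, by exact_mod_cast hhpos, disjoint_closedHull_add_of_margin hW hAH hs hm0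
    (fun a ha ↦ infDist_le_norm_map_sub ha) (Ω := m / 8) (fun r hr1 hr2 ↦ ?_) ?_⟩
  · have hr1' : (s : ℝ) ≤ r := by exact_mod_cast hr1
    have hd : dist r s < η := by
      rw [NNReal.dist_eq, abs_of_nonneg (by linarith : (0:ℝ) ≤ r - s)]
      have : (r : ℝ) ≤ s + h := by exact_mod_cast hr2
      linarith
    have := hmod hd
    rw [Real.dist_eq] at this
    exact this.le
  · have h1 : 4 * (h : ℝ) / m ≤ m / 8 := by
      rw [div_le_iff₀ hm0]; nlinarith
    linarith

/-- **An alive time lies strictly before `T_A`** (`A` a nonempty `*`-hull). [folklore] -/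
theorem lt_hullHitTime_of_disjoint (hW : Continuous W) (hA : IsStarHull A) (hne : A.Nonempty)
    {s : ℝ≥0} (hs : Disjoint (closedHull W s) A) : (s : WithTop ℝ≥0) < hullHitTime W A := by
  obtain ⟨h, hh, hsh⟩ := exists_disjoint_closedHull_add hW hA hne hs
  exact lt_of_lt_of_le (by exact_mod_cast lt_add_of_pos_right s hh) (le_hullHitTime_of_disjoint hsh)

/-- **The alive times of a nonempty `*`-hull are exactly `[0, T_A)`.** [cite: LawlerSchrammWerner2003Restriction, §5 (T = T_A)] -/
theorem disjoint_closedHull_iff_lt_hullHitTime (hW : Continuous W) (hA : IsStarHull A) (hne : A.Nonempty)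
    {s : ℝ≥0} : Disjoint (closedHull W s) A ↔ (s : WithTop ℝ≥0) < hullHitTime W A :=
  ⟨lt_hullHitTime_of_disjoint hW hA hne, disjoint_closedHull_of_lt_hullHitTime⟩

/-- The set of alive times is `{s | s < T_A}`. [folklore] -/
theorem setOf_disjoint_closedHull_eq (hW : Continuous W) (hA : IsStarHull A) (hne : A.Nonempty) :
    {s : ℝ≥0 | Disjoint (closedHull W s) A} = {s : ℝ≥0 | (s : WithTop ℝ≥0) < hullHitTime W A} := by
  ext s; exact disjoint_closedHull_iff_lt_hullHitTime hW hA hne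

/-! ### Continuity of `h_t'(W_t)` and `dist(0, B_t)` on `[0, T_A)` -/

/-- **`t ↦ Φ'_{B_t}(0) = h_t'(W_t)` is continuous on `[0, T_A)`** (`RestrictionDerivTime`).
[cite: LawlerSchrammWerner2003Restriction, §5 (h_t'(W_t) continuous)] -/
theorem continuousOn_starDeriv_slidHull (hW : Continuous W) (hA : IsStarHull A) (hne : A.Nonempty) :
    ContinuousOn (fun t : ℝ≥0 ↦ starDeriv (slidHull W A t))
      {t : ℝ≥0 | (t : WithTop ℝ≥0) < hullHitTime W A} := by
  rw [← setOf_disjoint_closedHull_eq hW hA hne]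
  exact fun s hs ↦ continuousWithinAt_starDeriv_slidHull hW hA hne hs

/-- **`t ↦ dist(0, B_t) = dist(W_t, g_t(A))` is continuous on `[0, T_A)`** (`RestrictionDerivTime`).
[cite: LawlerSchrammWerner2003Restriction, §5] -/
theorem continuousOn_infDist_slidHull (hW : Continuous W) (hA : IsStarHull A) (hne : A.Nonempty) :
    ContinuousOn (fun t : ℝ≥0 ↦ infDist 0 (slidHull W A t))
      {t : ℝ≥0 | (t : WithTop ℝ≥0) < hullHitTime W A} := by
  rw [← setOf_disjoint_closedHull_eq hW hA hne]
  exact fun s hs ↦ continuousWithinAt_infDist_slidHull hW hA hne hs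

/-! ### Degeneracy of the margin at a finite hitting time -/

/-- **Before a finite hitting time the margin degenerates**: if `T_A = T < ∞` (for a `*`-hull `A`)
then for every `μ > 0` and every `s < T` there is an alive time `t ∈ [s, T)` with
`dist(0, B_t) = dist(W_t, g_t(A)) < μ`. (Otherwise the uniform margin `μ` on `[s, T)`, the uniform
continuity of `W` on `[0, T + 1]` and `disjoint_closedHull_add_of_margin` would keep `A` alive
past `T`.) [cite: LawlerSchrammWerner2003Restriction, §5 (T = T_A)] -/
theorem exists_infDist_slidHull_lt (hW : Continuous W) (hA : IsStarHull A)
    {T : ℝ≥0} (hT : hullHitTime W A = T) {μ : ℝ} (hμ : 0 < μ) {s : ℝ≥0} (hs : s < T) :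
    ∃ t : ℝ≥0, s ≤ t ∧ t < T ∧ infDist 0 (slidHull W A t) < μ := by
  have hAH := hA.isBoundedHull.subset_closure
  by_contra H
  push Not at H
  -- uniform continuity of `W` on `[0, T + 1]`: `|W r - W r'| ≤ μ/8` when `|r - r'| ≤ ε`
  obtain ⟨ε, hε, hmod⟩ := exists_forall_abs_sub_driving_le hW ((T : ℝ) + 1) (η := μ / 8) (by positivity)
  -- the step `h = min ε (min 1 (μ²/32))` and the starting time `t = max s (T - h/2)`
  set h : ℝ := min ε (min 1 (μ ^ 2 / 32)) with hh
  have hh0 : 0 < h := lt_min hε (lt_min one_pos (by positivity))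
  have hhε : h ≤ ε := min_le_left _ _
  have hh1 : h ≤ 1 := (min_le_right _ _).trans (min_le_left _ _)
  have hhμ : h ≤ μ ^ 2 / 32 := (min_le_right _ _).trans (min_le_right _ _)
  have hT0 : (0 : ℝ) ≤ T := T.coe_nonneg
  set t : ℝ≥0 := max s ((T : ℝ) - h / 2).toNNReal with ht
  have hst : s ≤ t := le_max_left _ _
  have htT : t < T := by
    refine max_lt hs ?_
    rw [← NNReal.coe_lt_coe, Real.coe_toNNReal']
    exact max_lt (by linarith) (by exact_mod_cast (pos_of_gt hs))
  have htTh : (T : ℝ) < t + h := by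
    have : (T : ℝ) - h / 2 ≤ t := by
      have h1 : (((T : ℝ) - h / 2).toNNReal : ℝ) ≤ t := by exact_mod_cast le_max_right s _
      exact (Real.le_coe_toNNReal _).trans h1
    linarith
  -- alive at `t` with margin `μ`
  have halive : Disjoint (closedHull W t) A := disjoint_closedHull_of_lt_hullHitTime (by rw [hT]; exact_mod_cast htT)
  have hmar : ∀ a ∈ A, μ ≤ ‖map W t a - W t‖ := fun a ha ↦
    (H t hst htT).trans (infDist_le_norm_map_sub ha)
  -- the calm step
  set h' : ℝ≥0 := ⟨h, hh0.le⟩ with hh'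
  have hstep := disjoint_closedHull_add_of_margin hW hAH halive hμ hmar (h := h') (Ω := μ / 8)
    (fun r hr1 hr2 ↦ ?_) ?_
  · have hle := le_hullHitTime_of_disjoint hstep
    rw [hT, WithTop.coe_le_coe, ← NNReal.coe_le_coe, NNReal.coe_add] at hle
    change (t : ℝ) + h ≤ T at hle
    linarith
  · have hr2' : (r : ℝ) ≤ t + h := by exact_mod_cast hr2
    have hr1' : (t : ℝ) ≤ r := by exact_mod_cast hr1
    have htTr : (t : ℝ) < T := by exact_mod_cast htT
    have htT1 : (t : ℝ) ≤ T + 1 := by linarith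
    have := hmod r ⟨r.coe_nonneg, by linarith⟩ t ⟨t.coe_nonneg, htT1⟩
      (by rw [abs_of_nonneg (by linarith : (0:ℝ) ≤ r - t)]; linarith)
    simpa only [Real.toNNReal_coe] using this
  · have h1 : 4 * (h' : ℝ) / μ ≤ μ / 8 := by
      change 4 * h / μ ≤ μ / 8
      rw [div_le_iff₀ hμ]; nlinarith
    linarith

end Loewner

end Literature.Probability.RandomPlanarGeometry

end
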